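import Summits.AnomalousDissipation.AnomalousDissipation.Theorems.BaireTransferRobustLoudUpgradeLineLeaf
import Summits.AnomalousDissipation.AnomalousDissipation.Theorems.BaireTransferRobustLoudUpgradeStubSteadyPersist
import Summits.AnomalousDissipation.AnomalousDissipation.Theorems.BaireTransferRobustLoudUpgradeStubSteadyWindow
import Summits.AnomalousDissipation.AnomalousDissipation.Theorems.BaireTransferRobustLoudUpgradeStubCensusInterior
import Summits.AnomalousDissipation.AnomalousDissipation.Theorems.BaireTransferRobustLoudUpgradeStubMalkinBordered
import Summits.AnomalousDissipation.AnomalousDissipation.Theorems.BaireTransferRobustLoudUpgradeStubBorderedCone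
import Summits.AnomalousDissipation.AnomalousDissipation.Theorems.BaireTransferRobustLoudUpgradeStubPeriodicWindow
import Summits.AnomalousDissipation.AnomalousDissipation.Theorems.BaireTransferRobustLoudUpgradeStubSteadyPersistLeaf
import Summits.AnomalousDissipation.AnomalousDissipation.Theorems.BaireTransferRobustLoudUpgradeStubSteadyWindowLeaf

/-!
# Line `malkin-cone-group-orbits`, COMPANION skeleton (lead c2) for the crux `BaireTransfer.RobustLoudUpgrade`
# (stmt-AnomalousDissipation-1144): the LYAPUNOV–SCHMIDT CROSSING family of a simply degenerate steady witness

Companion of the generation-1 skeleton v5 (`Lines/malkin_cone_group_orbits.lean`, lead `…-1144-1`) and of the laminar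
companion (`Lines/malkin_cone_group_orbits_c1.lean`, lead `…-c1-0`).  This file does NOT reshape those skeletons and
registers its stubs ADDITIVELY (`workitem stub-add`).

Crux (fixed, by name): `∃ S₀ ∀ S ⊇ S₀ ∀ E ε, 0 < ε → ∀ j, LOUD_j(S,E,ε) ⊆ closure (interior LOUD_j(S,2E,ε/2))`.

SCOPE.  v5 leaves open, among steady witnesses with a ONE-dimensional kernel, the INVISIBLE degeneracies: the
cokernel of `L(ν,u₀)` is orthogonal to every `f_d`, `d ∈ P_S` (the radial mode `d = c` included, so that — by the
Navier–Stokes scaling `(u,ν,f) ↦ (λu, λν, λ²f)` — the viscosity does not unfold the degeneracy at first order either).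
The tool of this companion is the genuine Lyapunov–Schmidt family of the witness: border the steady lattice map by an
ARBITRARY admissible smooth field `h ∉ range L(ν,u₀)` (a cokernel representative always qualifies; no visibility inside
`P_S` is asked) and FREE the kernel coordinate `x` (phase condition `∫⟪v, u' − u₀⟫ = x`).  The bordered implicit
function theorem gives a real function `σ(c', x)` near `(c, 0)` and states `υ(c', x)` of the corrected forces
`f_{c'} − σ(c',x) h`, TOGETHER WITH UNIQUENESS: the mean-zero steady states of `f_{c'}` near `u₀` are exactly the
`υ(c', x)` with `σ(c', x) = 0`.  Two pure-topology engines then upgrade: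

* (E1) CROSSING — `σ(c, ·)` takes both signs in every neighbourhood of `0` ⇒ `SteadyPersistsAt S c ν u₀`
  (intermediate value theorem), i.e. `c ∈ persistSteady ⊆ interior LOUD` (landed `stub_steadyWindow`): the index-`±1`
  case — cusps, pitchfork centres, every odd-order simple degeneracy, VISIBLE OR NOT;
* (E2) ROBUST CROSSING — `c` is a limit of forces `c₁` at which `σ(c₁, ·)` changes sign near `0` ⇒
  `c ∈ closure (interior LOUD)` (card trace-free-strain-robust-crossing, lemma C1): visible folds WITHOUT isolation,
  invisible folds with one discriminant-positive direction.

What survives (E1)+(E2) in the simple-kernel steady case is exactly the all-directions ISOLA CENTRE (`σ` one-signed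
near `(c,0)`) — the Disproof's VERDICT (K-window) obstruction.  First concrete member with no jet computation (cycle 2):
the SUBHARMONIC PITCHFORK CENTRE (force and `u₀` invariant under a lattice translation `b`, `u₀` isolated, simple
`b`-antiperiodic kernel: equivariance + uniqueness ⇒ `σ(c,·)` odd; isolation ⇒ non-zero off `0`; (E1)).

Registered stubs of this companion (Pi-form, no new vocabulary in the signatures):
* `stub_crossingPersist`      — (E1), pure topology (worker);
* `stub_robustCrossingClosure` — (E2), topology + the Peter–Paul window (worker);
* `stub_lsFamily`              — the Lyapunov–Schmidt family on the steady Fourier lattice (lead c2; template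
  `MalkinBordered.exists_bordered_correction`, abstract input `Literature.Analysis.Calculus.bordered_implicit_family`,
  the free-phase / external-border / uniqueness variant of `bordered_implicit`, landed separately under Literature);
* `stub_subharmonicSign`       — ℤ₂ bookkeeping: oddness of `σ(c, ·)` at a half-period-symmetric configuration (worker).
The residual is NOT re-registered here (it is the generation-1 lead's `stub_tameDenseSimple`); the composition below is
parametric in the tame union, exactly like the laminar companion's `line_glue_c1`.
-/

set_option linter.dupNamespace false

noncomputable section

open scoped BigOperators Topology
open Filter Set Function TopologicalSpace MeasureTheory UnitAddTorus

namespace Summit.AnomalousDissipation.AnomalousDissipation.Cruxes.RobustLoudUpgrade.LSCrossing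

open Literature.Analysis.FunctionSpaces Literature.Analysis.FunctionSpaces.Torus
open Literature.Analysis.FunctionSpaces.EuclideanSpace
open Literature.Analysis.FluidPDE
open Summit.AnomalousDissipation.AnomalousDissipation.Theses.BaireTransfer
open Summit.AnomalousDissipation.AnomalousDissipation.Theorems.RobustLoudUpgrade

/-- The flat unit torus `T³`. -/
local notation "𝕋³" => UnitAddTorus (Fin 3)
/-- Real velocity values. -/
local notation "ℝ³" => EuclideanSpace ℝ (Fin 3)

/-! ## §1 The two interface classes (crossing / robust crossing of a Lyapunov–Schmidt family) -/

/-- **Crossing steady witnesses** (interface of engine (E1)).  `c` carries, at some `ν ∈ (0,a)`, a mean-zero classical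
steady state `u₀` with STRICT budgets and a real function `σ` on `P_S × ℝ` such that (i) for every `δ > 0`, on some ball
around `(c, 0)`, `σ` is continuous and each of its ZEROS `q = (c', x)` yields a mean-zero classical steady state of the
UNCORRECTED force `f_{c'}` within squared `H¹`-distance `δ` of `u₀` (what the Lyapunov–Schmidt family delivers), and
(ii) `x ↦ σ(c, x)` takes BOTH signs in every neighbourhood of `0` (odd index). [folklore] -/
def crossingSteady (S : Finset (Fin 3 → ℤ)) (a E ε : ℝ) : Set (Coeff S) :=
  {c | ∃ ν : ℝ, 0 < ν ∧ ν < a ∧ ∃ (u₀ : 𝕋³ → ℝ³) (p₀ : 𝕋³ → ℝ),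
    Torus.IsSteadyNSState ν (force S c) u₀ p₀ ∧ HasZeroMean u₀ ∧ meanEnergy (fun _ : ℝ => u₀) < E ∧
      ε < meanDissipation ν (fun _ : ℝ => u₀) ∧
      ∃ σ : Coeff S × ℝ → ℝ,
        (∀ δ : ℝ, 0 < δ → ∃ r : ℝ, 0 < r ∧ ContinuousOn σ (Metric.ball (c, (0 : ℝ)) r) ∧
          ∀ q ∈ Metric.ball (c, (0 : ℝ)) r, σ q = 0 →
            ∃ (u' : 𝕋³ → ℝ³) (p' : 𝕋³ → ℝ), Torus.IsSteadyNSState ν (force S q.1) u' p' ∧ HasZeroMean u' ∧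
              h1DistSq u' u₀ < δ) ∧
        ∀ η : ℝ, 0 < η → ∃ x₁ x₂ : ℝ, |x₁| < η ∧ |x₂| < η ∧ σ (c, x₁) < 0 ∧ 0 < σ (c, x₂)}

/-- **Robustly crossing steady witnesses** (interface of engine (E2)): as `crossingSteady`, except that the sign
change of `σ(c₁, ·)` near `0` is only asked at forces `c₁` ARBITRARILY CLOSE to `c` (not at `c` itself). [folklore] -/
def robustCrossingSteady (S : Finset (Fin 3 → ℤ)) (a E ε : ℝ) : Set (Coeff S) :=
  {c | ∃ ν : ℝ, 0 < ν ∧ ν < a ∧ ∃ (u₀ : 𝕋³ → ℝ³) (p₀ : 𝕋³ → ℝ),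
    Torus.IsSteadyNSState ν (force S c) u₀ p₀ ∧ HasZeroMean u₀ ∧ meanEnergy (fun _ : ℝ => u₀) < E ∧
      ε < meanDissipation ν (fun _ : ℝ => u₀) ∧
      ∃ σ : Coeff S × ℝ → ℝ,
        (∀ δ : ℝ, 0 < δ → ∃ r : ℝ, 0 < r ∧ ContinuousOn σ (Metric.ball (c, (0 : ℝ)) r) ∧
          ∀ q ∈ Metric.ball (c, (0 : ℝ)) r, σ q = 0 →
            ∃ (u' : 𝕋³ → ℝ³) (p' : 𝕋³ → ℝ), Torus.IsSteadyNSState ν (force S q.1) u' p' ∧ HasZeroMean u' ∧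
              h1DistSq u' u₀ < δ) ∧
        ∀ η : ℝ, 0 < η → ∃ (c₁ : Coeff S) (x₁ x₂ : ℝ), dist c₁ c < η ∧ |x₁| < η ∧ |x₂| < η ∧
          σ (c₁, x₁) < 0 ∧ 0 < σ (c₁, x₂)}

/-! ## §2 The registered stubs of the companion -/

/-- **stub_crossingPersist** (engine (E1); pure topology; Pi-form; OPEN — wave 1).  If the zeros of a real function
`σ`, continuous near `(c, 0)`, produce mean-zero steady states of the uncorrected forces `H¹`-close to `u₀` (for every
`δ` on a suitable ball), and `σ(c, ·)` takes both signs arbitrarily close to `0`, then `u₀` PERSISTS: by continuity the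
two signs survive at every `c'` near `c`, and the intermediate value theorem gives a zero `(c', x)`. [folklore] -/
theorem stub_crossingPersist :
    ∀ (S : Finset (Fin 3 → ℤ)) (c : Coeff S) (ν : ℝ) (u₀ : UnitAddTorus (Fin 3) → EuclideanSpace ℝ (Fin 3))
      (σ : Coeff S × ℝ → ℝ),
      (∀ δ : ℝ, 0 < δ → ∃ r : ℝ, 0 < r ∧ ContinuousOn σ (Metric.ball (c, (0 : ℝ)) r) ∧
        ∀ q ∈ Metric.ball (c, (0 : ℝ)) r, σ q = 0 →
          ∃ (u' : UnitAddTorus (Fin 3) → EuclideanSpace ℝ (Fin 3)) (p' : UnitAddTorus (Fin 3) → ℝ),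
            Torus.IsSteadyNSState ν (force S q.1) u' p' ∧ HasZeroMean u' ∧ h1DistSq u' u₀ < δ) →
      (∀ η : ℝ, 0 < η → ∃ x₁ x₂ : ℝ, |x₁| < η ∧ |x₂| < η ∧ σ (c, x₁) < 0 ∧ 0 < σ (c, x₂)) →
      SteadyPersistsAt S c ν u₀ := by
  sorry

/-- **stub_robustCrossingClosure** (engine (E2); topology + window; Pi-form; OPEN — wave 1).  If `u₀` is a classical
steady state of `f_c` at `ν ∈ (0,a)` with STRICT budgets, the zeros of `σ` (continuous near `(c,0)`) produce steady
states of the uncorrected forces `H¹`-close to `u₀`, and `σ(c₁, ·)` changes sign near `0` at forces `c₁` arbitrarily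
close to `c`, then `c ∈ closure (interior LOUD)`: the Peter–Paul window turns `H¹`-closeness into budgets, the sign change
at `c₁` survives on a ball around `c₁` (continuity), and the intermediate value theorem makes that whole ball loud.
[folklore] -/
theorem stub_robustCrossingClosure :
    ∀ (S : Finset (Fin 3 → ℤ)) (a E ε : ℝ) (c : Coeff S) (ν : ℝ)
      (u₀ : UnitAddTorus (Fin 3) → EuclideanSpace ℝ (Fin 3)) (p₀ : UnitAddTorus (Fin 3) → ℝ) (σ : Coeff S × ℝ → ℝ),
      0 < ν → ν < a → Torus.IsSteadyNSState ν (force S c) u₀ p₀ →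
      meanEnergy (fun _ : ℝ => u₀) < E → ε < meanDissipation ν (fun _ : ℝ => u₀) →
      (∀ δ : ℝ, 0 < δ → ∃ r : ℝ, 0 < r ∧ ContinuousOn σ (Metric.ball (c, (0 : ℝ)) r) ∧
        ∀ q ∈ Metric.ball (c, (0 : ℝ)) r, σ q = 0 →
          ∃ (u' : UnitAddTorus (Fin 3) → EuclideanSpace ℝ (Fin 3)) (p' : UnitAddTorus (Fin 3) → ℝ),
            Torus.IsSteadyNSState ν (force S q.1) u' p' ∧ h1DistSq u' u₀ < δ) →
      (∀ η : ℝ, 0 < η → ∃ (c₁ : Coeff S) (x₁ x₂ : ℝ), dist c₁ c < η ∧ |x₁| < η ∧ |x₂| < η ∧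
        σ (c₁, x₁) < 0 ∧ 0 < σ (c₁, x₂)) →
      c ∈ closure (interior (loud S a E ε)) := by
  sorry

/-- **stub_lsFamily** (the LYAPUNOV–SCHMIDT FAMILY of a simply degenerate steady state, bordered by an EXTERNAL
admissible field; analytic, on the steady Fourier lattice; Pi-form; OPEN — held by the lead c2).  Let `u₀` be a
mean-zero classical steady state of `NS_ν(f_c)`, `v` a smooth divergence-free mean-zero real field whose complex line
contains the classical mean-zero kernel of `L(ν,u₀)`, and `h` a smooth divergence-free mean-zero real field with
`h ∉ range L(ν,u₀)`.  Then there is `σ : P_S × ℝ → ℝ` with `σ(c,0) = 0`, differentiable at `(c,0)` with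
`∂ₓσ(c,0) = 0` and `∂_d σ(c,0) ≠ 0` for every first-order-visible `d ∈ P_S`, such that for every `δ > 0`, on a ball
around `(c,0)`: `σ` is continuous, `|σ| < δ`, and every corrected force `f_{c'} − σ(c',x) h` carries a mean-zero classical
steady state `u'` with `h1DistSq u' u₀ < δ`, lattice (`H²`-type) distance `< δ`, and phase `∫⟪v, u' − u₀⟫ = x`;
and UNIQUENESS: every mean-zero classical steady state `u''` of a force `f_{c'} − t h` with `(c', x, t)` small and
`u''` lattice-close to `u₀`, of phase `x`, has `t = σ(c', x)`.  (Bordering lemma + implicit function theorem with the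
free kernel coordinate; Chow–Hale 1982 §2.4/Ch. 6, Vanderbauwhede 1982 Ch. 8, Kielhöfer 2012 §I.2.) [folklore] -/
theorem stub_lsFamily :
    ∀ (S : Finset (Fin 3 → ℤ)) (c : Coeff S) (ν : ℝ) (u₀ : UnitAddTorus (Fin 3) → EuclideanSpace ℝ (Fin 3))
      (p₀ : UnitAddTorus (Fin 3) → ℝ) (v h : UnitAddTorus (Fin 3) → EuclideanSpace ℝ (Fin 3)),
      0 < ν → Torus.IsSteadyNSState ν (force S c) u₀ p₀ → HasZeroMean u₀ →
      IsSmooth v → IsDivFree v → HasZeroMean v →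
      (∀ w, Torus.LinNSResolventRel ν u₀ 0 w 0 → ∃ z : ℂ, w = z • cplx v) →
      IsSmooth h → IsDivFree h → HasZeroMean h →
      (∀ w, ¬ Torus.LinNSResolventRel ν u₀ 0 w (cplx h)) →
      ∃ σ : Coeff S × ℝ → ℝ, σ (c, 0) = 0 ∧
        (∃ ℓ : Coeff S × ℝ →L[ℝ] ℝ, HasFDerivAt σ ℓ (c, 0) ∧ ℓ (0, 1) = 0 ∧
          ∀ d : Coeff S, (∀ w, ¬ Torus.LinNSResolventRel ν u₀ 0 w (cplx (force S d))) → ℓ (d, 0) ≠ 0) ∧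
        (∀ δ : ℝ, 0 < δ → ∃ r : ℝ, 0 < r ∧ ContinuousOn σ (Metric.ball (c, (0 : ℝ)) r) ∧
          ∀ q ∈ Metric.ball (c, (0 : ℝ)) r, |σ q| < δ ∧
            ∃ (u' : UnitAddTorus (Fin 3) → EuclideanSpace ℝ (Fin 3)) (p' : UnitAddTorus (Fin 3) → ℝ),
              Torus.IsSteadyNSState ν (fun y => force S q.1 y - σ q • h y) u' p' ∧ HasZeroMean u' ∧
                h1DistSq u' u₀ < δ ∧
                (∑' k : Fin 3 → ℤ, freqNormSq k ^ 2 *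
                    ‖mFourierCoeff (complexify ∘ u') k - mFourierCoeff (complexify ∘ u₀) k‖ ^ 2) < δ ∧
                (∫ y, inner ℝ (v y) (u' y - u₀ y)) = q.2) ∧
        ∃ ρ : ℝ, 0 < ρ ∧ ∀ (c' : Coeff S) (x t : ℝ) (u'' : UnitAddTorus (Fin 3) → EuclideanSpace ℝ (Fin 3))
          (p'' : UnitAddTorus (Fin 3) → ℝ),
          dist c' c < ρ → |x| < ρ → |t| < ρ →
          Torus.IsSteadyNSState ν (fun y => force S c' y - t • h y) u'' p'' → HasZeroMean u'' →
          (∑' k : Fin 3 → ℤ, freqNormSq k ^ 2 *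
              ‖mFourierCoeff (complexify ∘ u'') k - mFourierCoeff (complexify ∘ u₀) k‖ ^ 2) < ρ →
          (∫ y, inner ℝ (v y) (u'' y - u₀ y)) = x → t = σ (c', x) := by
  sorry

/-! ## §3 Glue (sorry-free modulo the stubs) -/

/-- **(E1)** `crossingSteady ⊆ persistSteady` (hence `⊆ interior LOUD` by the landed `stub_steadyWindow`). [folklore] -/
theorem crossingSteady_subset_persistSteady (S : Finset (Fin 3 → ℤ)) (a E ε : ℝ) :
    crossingSteady S a E ε ⊆ persistSteady S a E ε := by
  intro c hc
  obtain ⟨ν, hν, hνa, u₀, p₀, hst, h0, hE, hε, σ, hfam, hsign⟩ := hc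
  exact ⟨ν, hν, hνa, u₀, p₀, hst, h0, hE, hε, stub_crossingPersist S c ν u₀ σ hfam hsign⟩

/-- **(E1), concluded**: `crossingSteady ⊆ interior LOUD` at the same strict budgets. [folklore] -/
theorem crossingSteady_subset_interior_loud (S : Finset (Fin 3 → ℤ)) (a E ε : ℝ) :
    crossingSteady S a E ε ⊆ interior (loud S a E ε) :=
  (crossingSteady_subset_persistSteady S a E ε).trans (SteadyWindow.stub_steadyWindow S a E ε)

/-- **(E2)** `robustCrossingSteady ⊆ closure (interior LOUD)` at the same strict budgets. [folklore] -/
theorem robustCrossingSteady_subset_closure_interior_loud (S : Finset (Fin 3 → ℤ)) (a E ε : ℝ) :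
    robustCrossingSteady S a E ε ⊆ closure (interior (loud S a E ε)) := by
  intro c hc
  obtain ⟨ν, hν, hνa, u₀, p₀, hst, -, hE, hε, σ, hfam, hsign⟩ := hc
  refine stub_robustCrossingClosure S a E ε c ν u₀ p₀ σ hν hνa hst hE hε (fun δ hδ => ?_) hsign
  obtain ⟨r, hr, hcont, hzero⟩ := hfam δ hδ
  exact ⟨r, hr, hcont, fun q hq hσ => by
    obtain ⟨u', p', hst', -, hd⟩ := hzero q hq hσ
    exact ⟨u', p', hst', hd⟩⟩

/-- **A crossing at `c` is in particular a robust crossing** (take `c₁ = c`). [folklore] -/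
theorem crossingSteady_subset_robustCrossingSteady (S : Finset (Fin 3 → ℤ)) (a E ε : ℝ) :
    crossingSteady S a E ε ⊆ robustCrossingSteady S a E ε := by
  intro c hc
  obtain ⟨ν, hν, hνa, u₀, p₀, hst, h0, hE, hε, σ, hfam, hsign⟩ := hc
  refine ⟨ν, hν, hνa, u₀, p₀, hst, h0, hE, hε, σ, hfam, fun η hη => ?_⟩
  obtain ⟨x₁, x₂, h₁, h₂, hs₁, hs₂⟩ := hsign η hη
  exact ⟨c, x₁, x₂, by rw [dist_self]; exact hη, h₁, h₂, hs₁, hs₂⟩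

/-! ## §4 First concrete member: the SUBHARMONIC (ℤ₂-translation) PITCHFORK CENTRE

A lattice translation `y ↦ y + b` of `T³` acts on fields by `(T_b u)(y) = u(y + b)`; the steady Navier–Stokes system is
`T_b`-equivariant (Disproof.lean §11).  When `f_c(· + b) = f_c` (for `2b = 0`: the modes with `k·(2b) odd` are absent —
a SUB-LATTICE force) a symmetry-breaking simple kernel is `T_b`-ANTIsymmetric, `v(· + b) = −v` (the subharmonic mode:
the card trace-free-strain-robust-crossing's `2 + 4ℤ³` selection-rule scenario, where every first-order test inside the
sub-lattice family vanishes identically). -/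

/-- **stub_subharmonicSign** (pure symmetry bookkeeping; Pi-form; OPEN — wave 1).  If `f_c` and `u₀` are
`b`-periodic, the kernel field `v` and the border field `h` are `b`-antiperiodic, and `σ(c, ·)` is pinned by the
Lyapunov–Schmidt family at `c' = c` (existence of the corrected steady states, lattice-close to `u₀`, of phase `x`) and
by its uniqueness clause, then `σ(c, ·)` is ODD near `0`: translate the family member at `x` by `b`; it is a mean-zero
steady state of `f_c − (−σ(c,x)) h`, lattice-close to `u₀` (the Fourier coefficients only pick up the phases
`e_k(b)`, which `û₀` absorbs), of phase `−x`; uniqueness gives `σ(c, −x) = −σ(c, x)`. [folklore] -/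
theorem stub_subharmonicSign :
    ∀ (S : Finset (Fin 3 → ℤ)) (c : Coeff S) (ν : ℝ) (b : UnitAddTorus (Fin 3))
      (u₀ v h : UnitAddTorus (Fin 3) → EuclideanSpace ℝ (Fin 3)) (σ : Coeff S × ℝ → ℝ) (ρ : ℝ),
      (∀ y, force S c (y + b) = force S c y) → (∀ y, u₀ (y + b) = u₀ y) → (∀ y, v (y + b) = -v y) →
      (∀ y, h (y + b) = -h y) → IsSmooth u₀ → IsSmooth v →
      (∀ δ : ℝ, 0 < δ → ∃ r : ℝ, 0 < r ∧ ∀ x : ℝ, |x| < r → |σ (c, x)| < δ ∧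
        ∃ (u' : UnitAddTorus (Fin 3) → EuclideanSpace ℝ (Fin 3)) (p' : UnitAddTorus (Fin 3) → ℝ),
          Torus.IsSteadyNSState ν (fun y => force S c y - σ (c, x) • h y) u' p' ∧ HasZeroMean u' ∧
            (∑' k : Fin 3 → ℤ, freqNormSq k ^ 2 *
                ‖mFourierCoeff (complexify ∘ u') k - mFourierCoeff (complexify ∘ u₀) k‖ ^ 2) < δ ∧
            (∫ y, inner ℝ (v y) (u' y - u₀ y)) = x) →
      0 < ρ →
      (∀ (x t : ℝ) (u'' : UnitAddTorus (Fin 3) → EuclideanSpace ℝ (Fin 3)) (p'' : UnitAddTorus (Fin 3) → ℝ),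
        |x| < ρ → |t| < ρ →
        Torus.IsSteadyNSState ν (fun y => force S c y - t • h y) u'' p'' → HasZeroMean u'' →
        (∑' k : Fin 3 → ℤ, freqNormSq k ^ 2 *
            ‖mFourierCoeff (complexify ∘ u'') k - mFourierCoeff (complexify ∘ u₀) k‖ ^ 2) < ρ →
        (∫ y, inner ℝ (v y) (u'' y - u₀ y)) = x → t = σ (c, x)) →
      ∃ r₀ : ℝ, 0 < r₀ ∧ ∀ x : ℝ, |x| < r₀ → σ (c, -x) = -σ (c, x) := by
  sorry

/-- **Subharmonic pitchfork centres** (first concrete member of `crossingSteady`).  For some `b ∈ T³`, `f_c` is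
`b`-periodic; `c` carries, at some `ν ∈ (0,a)`, a `b`-periodic mean-zero classical steady state `u₀` with strict
budgets, ISOLATED in `H¹` among the mean-zero steady states of `f_c` at `ν`, whose classical mean-zero kernel lies on the
complex line of one smooth divergence-free mean-zero `b`-ANTIperiodic real field `v` (the subharmonic symmetry-breaking
mode), together with one smooth divergence-free mean-zero `b`-antiperiodic real field `h ∉ range L(ν,u₀)` (a cokernel
representative; NOT required to lie in `P_S` — no visibility inside the force family is asked). [folklore] -/
def subharmonicSteady (S : Finset (Fin 3 → ℤ)) (a E ε : ℝ) : Set (Coeff S) :=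
  {c | ∃ b : 𝕋³, (∀ y, force S c (y + b) = force S c y) ∧ ∃ ν : ℝ, 0 < ν ∧ ν < a ∧ ∃ (u₀ : 𝕋³ → ℝ³) (p₀ : 𝕋³ → ℝ),
    Torus.IsSteadyNSState ν (force S c) u₀ p₀ ∧ HasZeroMean u₀ ∧ meanEnergy (fun _ : ℝ => u₀) < E ∧
      ε < meanDissipation ν (fun _ : ℝ => u₀) ∧ (∀ y, u₀ (y + b) = u₀ y) ∧
      (∃ ρ : ℝ, 0 < ρ ∧ ∀ (u' : 𝕋³ → ℝ³) (p' : 𝕋³ → ℝ), Torus.IsSteadyNSState ν (force S c) u' p' →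
        HasZeroMean u' → h1DistSq u' u₀ < ρ → u' = u₀) ∧
      ∃ (v h : 𝕋³ → ℝ³), IsSmooth v ∧ IsDivFree v ∧ HasZeroMean v ∧ (∀ y, v (y + b) = -v y) ∧
        (∀ w, Torus.LinNSResolventRel ν u₀ 0 w 0 → ∃ z : ℂ, w = z • cplx v) ∧
        IsSmooth h ∧ IsDivFree h ∧ HasZeroMean h ∧ (∀ y, h (y + b) = -h y) ∧
        ∀ w, ¬ Torus.LinNSResolventRel ν u₀ 0 w (cplx h)}

/-- A point `(c, x)` with `|x| < r` lies in the ball of radius `r` around `(c, 0)` (sup metric). [folklore] -/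
theorem mk_mem_ball {S : Finset (Fin 3 → ℤ)} (c : Coeff S) {x r : ℝ} (hx : |x| < r) :
    (c, x) ∈ Metric.ball (c, (0 : ℝ)) r := by
  rw [Metric.mem_ball, Prod.dist_eq, dist_self, Real.dist_eq, sub_zero]
  exact max_lt (lt_of_le_of_lt (abs_nonneg x) hx) hx

/-- **`subharmonicSteady ⊆ crossingSteady`** (from `stub_lsFamily` and `stub_subharmonicSign`): the
Lyapunov–Schmidt family bordered by `h` supplies `σ`; its zeros are steady states of the uncorrected forces; ISOLATION
makes `σ(c, x) ≠ 0` for small `x ≠ 0` (a zero would be a steady state of `f_c` itself, `H¹`-close to `u₀`, hence `= u₀`,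
of phase `x ≠ 0` — absurd); ODDNESS then puts both signs next to `0`. [folklore] -/
theorem subharmonicSteady_subset_crossingSteady (S : Finset (Fin 3 → ℤ)) (a E ε : ℝ) :
    subharmonicSteady S a E ε ⊆ crossingSteady S a E ε := by
  intro c hc
  obtain ⟨b, hodd, ν, hν, hνa, u₀, p₀, hst, h0, hE, hε, hu₀odd, ⟨ρ₁, hρ₁, hiso⟩, v, h, hv₁, hv₂, hv₃, hveven, hker,
    hh₁, hh₂, hh₃, hheven, hvis⟩ := hc
  have hsm₀ : IsSmooth u₀ := hst.smooth_velocity.isSmooth_slice (Set.mem_univ (0 : ℝ))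
  obtain ⟨σ, hσ0, -, hfam, ρ, hρ, huniq⟩ :=
    stub_lsFamily S c ν u₀ p₀ v h hν hst h0 hv₁ hv₂ hv₃ hker hh₁ hh₂ hh₃ hvis
  -- the family clause, specialised to `c' = c`
  have hfam_c : ∀ δ : ℝ, 0 < δ → ∃ r : ℝ, 0 < r ∧ ∀ x : ℝ, |x| < r → |σ (c, x)| < δ ∧
      ∃ (u' : 𝕋³ → ℝ³) (p' : 𝕋³ → ℝ), Torus.IsSteadyNSState ν (fun y => force S c y - σ (c, x) • h y) u' p' ∧
        HasZeroMean u' ∧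
        (∑' k : Fin 3 → ℤ, freqNormSq k ^ 2 *
            ‖mFourierCoeff (complexify ∘ u') k - mFourierCoeff (complexify ∘ u₀) k‖ ^ 2) < δ ∧
        (∫ y, inner ℝ (v y) (u' y - u₀ y)) = x := by
    intro δ hδ
    obtain ⟨r, hr, -, hball⟩ := hfam δ hδ
    refine ⟨r, hr, fun x hx => ?_⟩
    obtain ⟨hσ, u', p', hst', hm', -, hlat, hph⟩ := hball (c, x) (mk_mem_ball c hx)
    exact ⟨hσ, u', p', hst', hm', hlat, hph⟩
  -- oddness of `σ(c, ·)` near `0`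
  obtain ⟨r₀, hr₀, hoddσ⟩ := stub_subharmonicSign S c ν b u₀ v h σ ρ hodd hu₀odd hveven hheven hsm₀ hv₁ hfam_c hρ
    (fun x t u'' p'' hx ht hst'' hm'' hlat hph => huniq c x t u'' p'' (by rw [dist_self]; exact hρ) hx ht hst'' hm''
      hlat hph)
  refine ⟨ν, hν, hνa, u₀, p₀, hst, h0, hE, hε, σ, fun δ hδ => ?_, fun η hη => ?_⟩
  · -- zeros of `σ` are steady states of the uncorrected force
    obtain ⟨r, hr, hcont, hball⟩ := hfam δ hδ
    refine ⟨r, hr, hcont, fun q hq hσq => ?_⟩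
    obtain ⟨-, u', p', hst', hm', hd, -, -⟩ := hball q hq
    refine ⟨u', p', ?_, hm', hd⟩
    have e : (fun y => force S q.1 y - σ q • h y) = force S q.1 := by
      funext y; rw [hσq, zero_smul, sub_zero]
    rwa [e] at hst'
  · -- isolation ⇒ `σ(c, x) ≠ 0` for small `x ≠ 0`; oddness ⇒ both signs
    obtain ⟨r, hr, -, hball⟩ := hfam ρ₁ hρ₁
    have hne : ∀ x : ℝ, |x| < r → x ≠ 0 → σ (c, x) ≠ 0 := by
      intro x hx hx0 hσx
      obtain ⟨-, u', p', hst', hm', hd, -, hph⟩ := hball (c, x) (mk_mem_ball c hx)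
      have e : (fun y => force S ((c, x) : Coeff S × ℝ).1 y - σ (c, x) • h y) = force S c := by
        funext y; rw [hσx, zero_smul, sub_zero]
      rw [e] at hst'
      have hu' : u' = u₀ := hiso u' p' hst' hm' hd
      rw [hu'] at hph
      simp only [sub_self, inner_zero_right, integral_zero] at hph
      exact hx0 hph.symm
    set x : ℝ := min (η / 2) (min (r / 2) (r₀ / 2)) with hx
    have hx0 : 0 < x := lt_min (by linarith) (lt_min (by linarith) (by linarith))
    have hxη : |x| < η := by rw [abs_of_pos hx0]; exact (min_le_left _ _).trans_lt (by linarith)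
    have hxr : |x| < r := by
      rw [abs_of_pos hx0]; exact ((min_le_right _ _).trans (min_le_left _ _)).trans_lt (by linarith)
    have hxr₀ : |x| < r₀ := by
      rw [abs_of_pos hx0]; exact ((min_le_right _ _).trans (min_le_right _ _)).trans_lt (by linarith)
    have hσx : σ (c, x) ≠ 0 := hne x hxr hx0.ne'
    have hσnx : σ (c, -x) = -σ (c, x) := hoddσ x hxr₀
    have hnxη : |(-x)| < η := by rwa [abs_neg]
    rcases lt_or_gt_of_ne hσx with hneg | hpos
    · exact ⟨x, -x, hxη, hnxη, hneg, by rw [hσnx]; linarith⟩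
    · exact ⟨-x, x, hnxη, hxη, by rw [hσnx]; linarith, hpos⟩

/-! ## §5 Composition (sorry-free modulo the stubs and a residual): the enlarged tame union proves the crux BY NAME -/

/-- **Every tame witness class of v4 is force-open up to closure** (the six LANDED upgrade theorems). [folklore] -/
theorem tameLeaf_subset_closure_interior_loud (S : Finset (Fin 3 → ℤ)) (a E ε : ℝ) :
    tameLeaf S a E ε ⊆ closure (interior (loud S a E ε)) :=
  tameLeaf_subset_closure_interior SteadyPersistLeaf.stub_steadyPersistLeaf SteadyWindowLeaf.stub_steadyWindowLeaf
    CensusInterior.stub_censusInterior MalkinBordered.stub_malkinBordered BorderedCone.stub_borderedCone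
    PeriodicWindow.stub_periodicWindow S a E ε

/-- The tame union of the companion c2: v4's `tameLeaf` plus the two crossing classes plus the pitchfork centres.
[folklore] -/
def tameCrossing (S : Finset (Fin 3 → ℤ)) (a E ε : ℝ) : Set (Coeff S) :=
  tameLeaf S a E ε ∪ crossingSteady S a E ε ∪ robustCrossingSteady S a E ε ∪ subharmonicSteady S a E ε

/-- **The enlarged tame union is force-open up to closure.** [folklore] -/
theorem tameCrossing_subset_closure_interior_loud (S : Finset (Fin 3 → ℤ)) (a E ε : ℝ) :
    tameCrossing S a E ε ⊆ closure (interior (loud S a E ε)) := by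
  refine Set.union_subset (Set.union_subset (Set.union_subset (tameLeaf_subset_closure_interior_loud S a E ε) ?_)
    (robustCrossingSteady_subset_closure_interior_loud S a E ε)) ?_
  · exact (crossingSteady_subset_interior_loud S a E ε).trans subset_closure
  · exact ((subharmonicSteady_subset_crossingSteady S a E ε).trans
      (crossingSteady_subset_interior_loud S a E ε)).trans subset_closure

/-- **Composition engine, parametric in the tame union** (pure topology; twin of the laminar companion's
`RobustLoudUpgrade_of_turbulentResidual`): any union `T ⊇ tameCrossing`-or-not that upgrades to `closure (interior LOUD)`
together with a residual `LOUD ⊆ closure T(2E, ε/2)` over the unit stock proves the crux BY NAME (`S₀ := unitStock`).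
[folklore] -/
theorem RobustLoudUpgrade_of_residual (T : ∀ S : Finset (Fin 3 → ℤ), ℝ → ℝ → ℝ → Set (Coeff S))
    (hT : ∀ (S : Finset (Fin 3 → ℤ)) (a E ε : ℝ), T S a E ε ⊆ closure (interior (loud S a E ε)))
    (hRes : ∀ S : Finset (Fin 3 → ℤ), unitStock ⊆ S → ∀ (a E ε : ℝ), 0 < a → 0 < ε →
      loud S a E ε ⊆ closure (T S a (2 * E) (ε / 2))) :
    RobustLoudUpgrade := by
  refine ⟨unitStock, fun S hS E ε hε j => ?_⟩
  have ha : (0 : ℝ) < 1 / ((j : ℝ) + 1) := by positivity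
  intro c hc
  exact closure_minimal (hT S _ _ _) isClosed_closure (hRes S hS _ E ε ha hε hc)

/-- **Residual of the companion (NOT registered — the residual bet of the line is the generation-1 lead's
`stub_tameDenseSimple`; this weaker-by-two-classes form only documents what the companion's classes buy).**  With the unit
stock in `S`, every loud force is a limit of forces in `tameLeaf ∪ crossingSteady ∪ robustCrossingSteady ∪ subharmonicSteady`
at budgets `(2E, ε/2)`.  Crux-sized: loud GHOSTS (all-directions isola centres), kernels of dimension `≥ 2`, non-symmetric
continua and degenerate time-periodic witnesses are not covered by any landed class. [folklore] -/
theorem residual_tameDenseCrossing :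
    ∀ S : Finset (Fin 3 → ℤ), unitStock ⊆ S → ∀ (a E ε : ℝ), 0 < a → 0 < ε →
      loud S a E ε ⊆ closure (tameCrossing S a (2 * E) (ε / 2)) := by
  sorry

/-- **The companion closes the crux modulo its stubs and the residual.** -/
theorem RobustLoudUpgrade_of_stubs :
    Summit.AnomalousDissipation.AnomalousDissipation.Theses.BaireTransfer.RobustLoudUpgrade :=
  RobustLoudUpgrade_of_residual (fun S a E ε => tameCrossing S a E ε) tameCrossing_subset_closure_interior_loud
    residual_tameDenseCrossing

end Summit.AnomalousDissipation.AnomalousDissipation.Cruxes.RobustLoudUpgrade.LSCrossing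

end
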